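import Summits.BirchSwinnertonDyer.BirchSwinnertonDyer.Theorems.ClassRecordThreeShimuraKolyvaginOrderBoundAtThreeSurjOrderEntry
import Summits.BirchSwinnertonDyer.BirchSwinnertonDyer.Theorems.ClassRecordThreeShimuraKolyvaginOrderBoundAtThreeSurjOrderReciprocity
import Summits.BirchSwinnertonDyer.BirchSwinnertonDyer.Theorems.ClassRecordThreeShimuraKolyvaginOrderBoundAtThreeSurjUnitIndex
import Summits.BirchSwinnertonDyer.Rank1Residual.Additive.X4RankZeroLowerKolyvaginIndexForm
import HarnessLib

/-!
# Crux `ShimuraKolyvaginOrderBoundAtThreeSurj` (item stmt-BirchSwinnertonDyer-19899; K2@3 + KOLY residual) — the END: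
# Kolyvagin's ORDER bound `#Ш(E/K)[3^∞] ≤ 3^(2·ord₃[E(K):ℤP])` as ONE kernel theorem modulo the
# ring-class-rational Shimura Euler-system carrier, Poitou–Tate and the Cassels–Tate inputs, on the Kodaira–Néron
# sub-locus at `3`

Cell `bsd-stepL` (run/shared/lean/pub/bsd-stepL/), seat `bsd-stepL-shim3a` (prover g2, PART 1b ACCEL row (6)),
HELPER for `Summit.BirchSwinnertonDyer.BirchSwinnertonDyer.Theses.ClassRecordThree.ShimuraKolyvaginOrderBoundAtThreeSurj`
(`--supports stmt-BirchSwinnertonDyer-19899 --as helper`; skeleton v2 e3c96ff7). Road memo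
HOME/shim/SHIM3A-G2-ROAD-19899.md. Sequel of the conductor-keyed ORDER machine (parts 1–8, this seat), the `p = 3`
local leaf `…SurjLocalShift` (p477215) and the unit-index slice `…SurjUnitIndex` (p477925).

## What this file proves

* `card_sha_three_primary_le_of_ringClassRationalPointsM_of_poitouTate_of_localDuality` — **McCallum 1991 §1
  Theorem (Kolyvagin), ORDER form, at `p = 3` for a Heegner-type Euler system rational over the ring class
  fields** (the case the crux needs: the CM points of `X_{N⁺,N⁻}`): `Ш(E/K)[3^∞]` finite, killed by `3^{M₀}`,
  `#Ш(E/K)[3^∞] ≤ 3^{2M₀}`, `ord₃ #Ш(E/K)[3^∞] ≤ 2M₀` for `3^{M₀} x₀ = P ∉ 3^{M₀+1}E(K)`, `M₀ ≥ 1` — GRANTED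
  `hpointsR` (the machine's point-level leaf with its Selmer clause (d) replaced by ring-class RATIONALITY,
  binder VERBATIM from shim-p1's `…InertMachineEntry` §4 at `p = 3`), `hPT`, the Kodaira–Néron clause at 3
  (`hTam`, the prime 3 included = the Tate-curve condition at `v ∣ 3`; `hKod`) and the displayed Cassels–Tate
  inputs at level `3^{M₀}`. Proof: part 8's conductor-keyed entry with clause (d) supplied by the `p = 3` leaf
  `kolyvaginClass_mem_selmerLocalKer_of_ringClassRational_three` and `hRT` by part 2's
  `kolyvaginReciprocityFinset_of_poitouTate_of_conductorNorm`.
* `natCard_sha_three_primary_le_pow_index_of_ringClassRationalPointsM_of_poitouTate_of_localDuality` — **the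
  crux's conclusion in its own INDEX form**, `Nat.card (primaryComponent (W.baseChange K).sha 3) ≤
  3 ^ (2 * padicValNat 3 (AddSubgroup.zmultiples P).index)`, for every `P ∈ E(K)` of infinite order and finite
  index carried by such data: McCallum's Lemma 5.1 (`M₀ = ord₃ index ⟺ 3^{M₀} ∥ P`, tree
  `Additive.zsmul_certificate_of_padicValNat_index`, using `E(K)[3] = 0` from `ρ̄_{E,3}` onto); `M₀ = 0` is the
  unit-index slice (`…SurjUnitIndex`), `M₀ ≥ 1` the previous theorem.

## Honest framing

THEOREMS ONLY (no `def`, no named fact, no `sorry`; axioms standard). This is NOT the crux and NOT stub A ∕ B: it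
is CONDITIONAL on (a) `hpointsR` — the Shimura CM-point Euler system of `X_{N⁺,N⁻}` in ring-class-rationality
currency (Bertolini–Darmon 1996 §2.3–2.6, Nekovář 2007 (4.8)–(4.13), Cai–Shu–Tian 2014: printed with proofs;
carrier port in progress by shim-p1, p-generic), (b) the cite-only named fact `hPT`, (c) the Kodaira–Néron clause
at 3 (NOT a clause of item 19899; off it the level-shift leaf needs Kolyvagin primes one level deeper than the
machine's Čebotarev step supplies), (d) the machine's Cassels–Tate inputs (Weil pairing alternating ∕
non-degenerate, local invariants with reciprocity and injectivity, `hH3`, Milne I 6.13(a), Gal(K∕ℚ)-equivariance —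
the tree's own open inputs, as for `X₀(N)`), (e) `0 < [E(K):ℤP]`; the crux's data `Dt X W' P₀ degS` and display
are not used (transport: shim3a g0's p468392). Item 19899 stays OPEN. BSD is not proved by any of this; no census
number moves.

## References

[cite: McCallumLMS1991, §1 Theorem (Kolyvagin), Lemma 5.1, §§4–5, Cor. 5.6] [cite: GrossLMS1991, §2 Prop. 2.1 (2), Thm. 2.2 (2)]
[cite: BertoliniDarmon1996, §2.3–2.6, Prop. 2.6] [cite: Nekovar2007, (4.8)–(4.13), (5.12)]
[cite: MilneADT2006, Ch. I Prop. 3.8, Thm. 4.10(b), §6 Thm. 6.13(a)] [cite: SilvermanAEC2009, Thm. VII.6.1]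
presearch: the order bound at (3 ∣ N⁺, N⁻ > 1) → NOT PRINTED (D-AUDIT-19526c4 Table C, lit g9; SHIM3A-MEMO §6:
corpus + galaxy); tree `lean search 'sha_three_primary_le_of_ringClassRationalPointsM'` → none.
-/

noncomputable section

open scoped Classical AddSubgroup
set_option linter.dupNamespace false
namespace Summit.BirchSwinnertonDyer.BirchSwinnertonDyer.Theorems.ShimuraKolyvaginLocalShift

open WeierstrassCurve NumberField IsDedekindDomain Field Function
  Literature.NumberTheory.EllipticCurves Literature.NumberTheory.EllipticCurves.KolyvaginCocycle
  Literature.NumberTheory.EllipticCurves.KolyvaginDescent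
  Literature.NumberTheory.EllipticCurves.RingClassField
  Literature.NumberTheory.GaloisRepresentations Literature.NumberTheory.GaloisCohomology
  Literature.NumberTheory.NumberFields Literature.NumberTheory.DiophantineGeometry
  Summit.BirchSwinnertonDyer.BirchSwinnertonDyer.Theorems
  Summit.BirchSwinnertonDyer.BirchSwinnertonDyer.Theorems.ShimuraKolyvaginOrder
open Literature.NumberTheory.GaloisRepresentations.DiscreteGaloisModule (mu MuCarrier)

-- Cup products need `LocallyCompactSpace Γ_K`; as in the tree's Cassels–Tate files.
attribute [local instance] absoluteGaloisGroup_compactSpace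

-- `CharZero` of the completions (the Cassels–Tate local terms), as in the tree's files.
attribute [local instance] charZero_placeCompletion

variable {K : Type} [Field K] [NumberField K]

/-- **McCallum 1991 §1 Theorem (Kolyvagin), ORDER form, at `p = 3`, for a Heegner-type Euler system rational over
the ring class fields, from Poitou–Tate and the Cassels–Tate inputs, on the Kodaira–Néron sub-locus** (module
docstring): for `3^{M₀} x₀ = P ∉ 3^{M₀+1}E(K)`, `M₀ ≥ 1`: `Ш(E/K)[3^∞]` finite, killed by `3^{M₀}`, of order
`≤ 3^{2M₀}`, `ord₃ ≤ 2M₀` — GRANTED `hpointsR`, `hPT`, `hTam ∧ hKod`, and the Cassels–Tate inputs. Proof: the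
conductor-keyed entry `card_sha_primary_le_at_of_pointsM_of_reciprocityFinset_of_localDuality_of_conductorNorm`
with clause (d) from `kolyvaginClass_mem_selmerLocalKer_of_ringClassRational_three` and `hRT` from
`kolyvaginReciprocityFinset_of_poitouTate_of_conductorNorm`. [cite: McCallumLMS1991, §1 Theorem (Kolyvagin), Cor. 5.6]
[cite: GrossLMS1991, §2 Thm. 2.2 (2)] [cite: MilneADT2006, Ch. I Thm. 4.10(b), §6 Thm. 6.13(a)] -/
theorem card_sha_three_primary_le_of_ringClassRationalPointsM_of_poitouTate_of_localDuality
    (hPT : poitouTate_sum_localTatePairing_eq_zero K)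
    (W : WeierstrassCurve ℚ) [W.IsElliptic] [W.IsGloballyMinimal] {N : ℕ} [NeZero N]
    (hN : W.conductorNorm ℤ = N) (hρ : W.HasSurjectiveModNGaloisRep 3) (hK : IsImaginaryQuadratic K)
    (ι : K →+* ℂ) {S : Finset ℕ}
    (hin : ∀ ℓ ∈ S, ℓ.Prime ∧ ℓ ∣ N ∧ ¬ ℓ ^ 2 ∣ N ∧
      ((Ideal.span {(ℓ : ℤ)}).primesOver (𝓞 K)).ncard = 1 ∧ ¬ (ℓ : ℤ) ∣ NumberField.discr K)
    (hsp : ∀ ℓ : ℕ, ℓ.Prime → ℓ ∣ N → ℓ ∉ S → ((Ideal.span {(ℓ : ℤ)}).primesOver (𝓞 K)).ncard = 2)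
    (hTam : ∀ (ℓ : ℕ) [Fact ℓ.Prime], ℓ ∉ S → W.HasMultiplicativeReductionAtPrime ℓ →
      ¬ 3 ∣ padicValInt ℓ W.minimalDiscriminantInt)
    (hKod : ∀ u : HeightOneSpectrum (𝓞 ℚ), W.HasAdditiveReductionAt u →
      W.kodairaSymbolAt u ≠ KodairaSymbol.IV ∧ W.kodairaSymbolAt u ≠ KodairaSymbol.IVstar)
    {P : (W.baseChange K).toAffine.Point} (hnt : ¬ IsOfFinAddOrder P)
    {M₀ : ℕ} (hM₀ : 1 ≤ M₀) [NeZero (3 ^ M₀)] {c : K ≃ₐ[ℚ] K} (hc : c ≠ 1) (hcc : c * c = 1)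
    {x₀ : (W.baseChange K).toAffine.Point} (hx₀ : 3 ^ M₀ • x₀ = P)
    (hmax : ∀ Q : (W.baseChange K).toAffine.Point, 3 ^ (M₀ + 1) • Q ≠ P)
    (hpointsR : ∀ {M : ℕ} (_hM : 1 ≤ M)
      (hdiv : ∀ Q : geomPoints (W.baseChange K), ∃ R, ((3 ^ M : ℕ) : ℤ) • R = Q)
      (c : K ≃ₐ[ℚ] K) (_hc : c ≠ 1),
      ∃ (ε : ℤ) (τ : AlgebraicClosure K ≃+* AlgebraicClosure K) (hτ : IsLiftOfAut c τ)
        (A : ℕ → AddSubgroup (geomPoints (W.baseChange K)))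
        (hA : ∀ m, KolyvaginCocycle.IsAdmissible (Field.absoluteGaloisGroup K) (A m)
          ((3 ^ M : ℕ) : ℤ))
        (emb : ∀ m : ℕ, ringClassField K ι m →ₐ[K] AlgebraicClosure K)
        (Pt : ℕ → geomPoints (W.baseChange K))
        (hPt : ∀ m, Pt m ∈
          KolyvaginCocycle.invPoints (Field.absoluteGaloisGroup K) (A m) ((3 ^ M : ℕ) : ℤ)),
        (ε = 1 ∨ ε = -1) ∧
        IsOfFinAddOrder (Affine.Point.map (W' := W) (c : K →ₐ[ℚ] K) P - ε • P) ∧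
        (∀ m, ∀ a ∈ A m, hτ.pointsMap W a ∈ A m) ∧
        Pt 1 = toGeomPoints (W.baseChange K) P ∧
        (∀ m, m ≠ 0 → ∀ a ∈ A m, ∀ Φ : Field.absoluteGaloisGroup K,
          (∀ x : ringClassField K ι m, Φ • emb m x = emb m x) → Φ • a = a) ∧
        (∀ m : ℕ, Squarefree m →
          (∀ q ∈ m.primeFactors, IsKolyvaginPrime N W K 3 q ∧ FrobEqFrobInfty W K (3 ^ M) q) →
          (∃ B ∈ A m, hτ.pointsMap W (Pt m) =
            (ε * (-1) ^ m.primeFactors.card) • Pt m + ((3 ^ M : ℕ) : ℤ) • B) ∧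
          (∀ ℓ : ℕ, ℓ.Prime → ℓ ∣ m → ∀ v : HeightOneSpectrum (𝓞 K), (ℓ : 𝓞 K) ∈ v.asIdeal →
            ∀ a : ℕ, (((3 : ℤ) ^ a) •
                kolyvaginClass (W.baseChange K) _ hdiv (hA m) (Pt m) (hPt m) ∈
                selmerLocalKer (W.baseChange K) (v.adicCompletion K) ((3 ^ M : ℕ) : ℤ) ↔
              ((3 : ℤ) ^ a) • kolyvaginClass (W.baseChange K) _ hdiv (hA (m / ℓ)) (Pt (m / ℓ))
                  (hPt (m / ℓ)) ∈
                (W.baseChange K).torsionLocalKer (v.adicCompletion K) ((3 ^ M : ℕ) : ℤ)))))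
    (e : geomTorsion (W.baseChange K) ((3 ^ M₀ * 3 ^ M₀ : ℕ) : ℤ) →
      geomTorsion (W.baseChange K) ((3 ^ M₀ * 3 ^ M₀ : ℕ) : ℤ) → AlgebraicClosure K)
    (hμ : ∀ S T, e S T ^ (3 ^ M₀ * 3 ^ M₀) = 1)
    (hadd₁ : ∀ S₁ S₂ T, e (S₁ + S₂) T = e S₁ T * e S₂ T)
    (hadd₂ : ∀ S T₁ T₂, e S (T₁ + T₂) = e S T₁ * e S T₂)
    (hgal : ∀ (σ : absoluteGaloisGroup K) (S T : geomTorsion (W.baseChange K) ((3 ^ M₀ * 3 ^ M₀ : ℕ) : ℤ)),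
      σ • e S T = e (σ • S) (σ • T))
    (halt : ∀ T, e T T = 1) (hnondeg : ∀ T, (∀ S, e S T = 1) → T = 0)
    (inv : LocalInvariants K (3 ^ M₀ * 3 ^ M₀)) (hPT' : inv.SumInvLocalizationEqZero)
    (hinv : ∀ v : HeightOneSpectrum (𝓞 K), Injective (inv (Sum.inr v)))
    (hH3 : ∀ x : galoisCohomology (mu K (3 ^ M₀ * 3 ^ M₀)) 3,
      (∀ v : Place K, galoisCohomology.localization (mu K (3 ^ M₀ * 3 ^ M₀)) v 3 x = 0) → x = 0)
    (hB : Literature.GroupTheory.FiniteAbelian.IsLevelPairing (3 ^ M₀)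
      (ctLevelPairing (W.baseChange K) (3 ^ M₀) e hμ hadd₁ hadd₂ hgal inv halt hPT' hH3
        (localTerm_finite_support (W := W.baseChange K) (m := 3 ^ M₀) (e := e) (hμ := hμ)
          (hadd₁ := hadd₁) (hadd₂ := hadd₂) (hgal := hgal) halt inv)))
    (hPτ : ∀ z ∈ selmerGroup (W.baseChange K) ((3 ^ M₀ * 3 ^ M₀ : ℕ) : ℤ),
      ∀ t ∈ selmerGroup (W.baseChange K) ((3 ^ M₀ * 3 ^ M₀ : ℕ) : ℤ),
      ctGeneralFun (W.baseChange K) (3 ^ M₀) e hμ hadd₁ hadd₂ hgal inv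
          (torsionH1ToH1 (W.baseChange K) _ (conjAct W c _ z))
          (torsionH1ToH1 (W.baseChange K) _ (conjAct W c _ t)) =
        ctGeneralFun (W.baseChange K) (3 ^ M₀) e hμ hadd₁ hadd₂ hgal inv
          (torsionH1ToH1 (W.baseChange K) _ z) (torsionH1ToH1 (W.baseChange K) _ t)) :
    Finite (AddCommGroup.primaryComponent (W.baseChange K).sha 3) ∧
    (∀ c ∈ AddCommGroup.primaryComponent (W.baseChange K).sha 3, 3 ^ M₀ • c = 0) ∧
    Nat.card (AddCommGroup.primaryComponent (W.baseChange K).sha 3) ≤ 3 ^ (2 * M₀) ∧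
    padicValNat 3 (Nat.card (AddCommGroup.primaryComponent (W.baseChange K).sha 3)) ≤ 2 * M₀ := by
  haveI : (W.baseChange K).IsElliptic := inferInstanceAs (W.map (algebraMap ℚ K)).IsElliptic
  refine card_sha_primary_le_at_of_pointsM_of_reciprocityFinset_of_localDuality_of_conductorNorm W hK hN hnt
    Nat.prime_three (by decide) hρ hM₀ hc hcc hx₀ hmax ?_
    (@fun _ hM _ hℓ _ ↦ kolyvaginReciprocityFinset_of_poitouTate_of_conductorNorm W hN hPT Nat.prime_three hM hℓ)
    e hμ hadd₁ hadd₂ hgal halt hnondeg inv hPT' hinv hH3 hB hPτ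
  intro M hM hdiv c₁ hc₁
  obtain ⟨ε, τ, hτ, A, hA, emb, Pt, hPt, hε, h53, hAτ, hPt1, hrat, hm'⟩ := hpointsR hM hdiv c₁ hc₁
  refine ⟨ε, τ, hτ, A, hA, Pt, hPt, hε, h53, hAτ, hPt1, fun m hm hk ↦ ⟨(hm' m hm hk).1, ?_, (hm' m hm hk).2⟩⟩
  intro v hv
  exact kolyvaginClass_mem_selmerLocalKer_of_ringClassRational_three hK ι (Squarefree.ne_zero hm) (emb m) W
    hN hin hsp hTam hKod (fun q hq ↦ (hk q hq).1.2.1) (hA m) (hrat m (Squarefree.ne_zero hm)) (hPt m) v hv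

/-- **The crux's conclusion in INDEX form, `#Ш(E/K)[3^∞] ≤ 3^(2·ord₃[E(K):ℤP])`, for a Heegner-type Euler
system rational over the ring class fields, from Poitou–Tate and the Cassels–Tate inputs, on the Kodaira–Néron
sub-locus** (module docstring; binders: the crux's `W`, `hN`, `ρ̄_{E,3}` onto, `K`, `hin`, `hsp` + `ι` +
`hTam ∧ hKod` + `P` non-torsion with `0 < [E(K):ℤP]` and `M₀ = padicValNat 3 [E(K):ℤP]` (the level of the
Cassels–Tate data) + `hpointsR` + `hPT` + the Cassels–Tate inputs at level `3^{M₀}`). McCallum's Lemma 5.1 (tree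
`Additive.zsmul_certificate_of_padicValNat_index`, with `E(K)[3] = 0` from `ρ̄_{E,3}` onto) gives
`3^{M₀} x₀ = P ∉ 3^{M₀+1}E(K)`; `M₀ = 0` is `…SurjUnitIndex`, `M₀ ≥ 1` the previous theorem. HONEST: conditional
on the carrier, `hPT`, the sub-locus clause and the Cassels–Tate inputs; item 19899 stays OPEN.
[cite: McCallumLMS1991, §1 Theorem (Kolyvagin), Lemma 5.1, Cor. 5.6] [cite: GrossLMS1991, §2 Prop. 2.1 (2), Thm. 2.2 (2)] -/
theorem natCard_sha_three_primary_le_pow_index_of_ringClassRationalPointsM_of_poitouTate_of_localDuality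
    (hPT : poitouTate_sum_localTatePairing_eq_zero K)
    (W : WeierstrassCurve ℚ) [W.IsElliptic] [W.IsGloballyMinimal] {N : ℕ} [NeZero N]
    (hN : W.conductorNorm ℤ = N) (hρ : W.HasSurjectiveModNGaloisRep 3) (hK : IsImaginaryQuadratic K)
    (ι : K →+* ℂ) {S : Finset ℕ}
    (hin : ∀ ℓ ∈ S, ℓ.Prime ∧ ℓ ∣ N ∧ ¬ ℓ ^ 2 ∣ N ∧
      ((Ideal.span {(ℓ : ℤ)}).primesOver (𝓞 K)).ncard = 1 ∧ ¬ (ℓ : ℤ) ∣ NumberField.discr K)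
    (hsp : ∀ ℓ : ℕ, ℓ.Prime → ℓ ∣ N → ℓ ∉ S → ((Ideal.span {(ℓ : ℤ)}).primesOver (𝓞 K)).ncard = 2)
    (hTam : ∀ (ℓ : ℕ) [Fact ℓ.Prime], ℓ ∉ S → W.HasMultiplicativeReductionAtPrime ℓ →
      ¬ 3 ∣ padicValInt ℓ W.minimalDiscriminantInt)
    (hKod : ∀ u : HeightOneSpectrum (𝓞 ℚ), W.HasAdditiveReductionAt u →
      W.kodairaSymbolAt u ≠ KodairaSymbol.IV ∧ W.kodairaSymbolAt u ≠ KodairaSymbol.IVstar)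
    {P : (W.baseChange K).toAffine.Point} (hnt : ¬ IsOfFinAddOrder P)
    (hidx0 : 0 < (AddSubgroup.zmultiples P).index) {M₀ : ℕ}
    (hv : padicValNat 3 (AddSubgroup.zmultiples P).index = M₀) [NeZero (3 ^ M₀)]
    {c : K ≃ₐ[ℚ] K} (hc : c ≠ 1) (hcc : c * c = 1)
    (hpointsR : ∀ {M : ℕ} (_hM : 1 ≤ M)
      (hdiv : ∀ Q : geomPoints (W.baseChange K), ∃ R, ((3 ^ M : ℕ) : ℤ) • R = Q)
      (c : K ≃ₐ[ℚ] K) (_hc : c ≠ 1),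
      ∃ (ε : ℤ) (τ : AlgebraicClosure K ≃+* AlgebraicClosure K) (hτ : IsLiftOfAut c τ)
        (A : ℕ → AddSubgroup (geomPoints (W.baseChange K)))
        (hA : ∀ m, KolyvaginCocycle.IsAdmissible (Field.absoluteGaloisGroup K) (A m)
          ((3 ^ M : ℕ) : ℤ))
        (emb : ∀ m : ℕ, ringClassField K ι m →ₐ[K] AlgebraicClosure K)
        (Pt : ℕ → geomPoints (W.baseChange K))
        (hPt : ∀ m, Pt m ∈
          KolyvaginCocycle.invPoints (Field.absoluteGaloisGroup K) (A m) ((3 ^ M : ℕ) : ℤ)),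
        (ε = 1 ∨ ε = -1) ∧
        IsOfFinAddOrder (Affine.Point.map (W' := W) (c : K →ₐ[ℚ] K) P - ε • P) ∧
        (∀ m, ∀ a ∈ A m, hτ.pointsMap W a ∈ A m) ∧
        Pt 1 = toGeomPoints (W.baseChange K) P ∧
        (∀ m, m ≠ 0 → ∀ a ∈ A m, ∀ Φ : Field.absoluteGaloisGroup K,
          (∀ x : ringClassField K ι m, Φ • emb m x = emb m x) → Φ • a = a) ∧
        (∀ m : ℕ, Squarefree m →
          (∀ q ∈ m.primeFactors, IsKolyvaginPrime N W K 3 q ∧ FrobEqFrobInfty W K (3 ^ M) q) →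
          (∃ B ∈ A m, hτ.pointsMap W (Pt m) =
            (ε * (-1) ^ m.primeFactors.card) • Pt m + ((3 ^ M : ℕ) : ℤ) • B) ∧
          (∀ ℓ : ℕ, ℓ.Prime → ℓ ∣ m → ∀ v : HeightOneSpectrum (𝓞 K), (ℓ : 𝓞 K) ∈ v.asIdeal →
            ∀ a : ℕ, (((3 : ℤ) ^ a) •
                kolyvaginClass (W.baseChange K) _ hdiv (hA m) (Pt m) (hPt m) ∈
                selmerLocalKer (W.baseChange K) (v.adicCompletion K) ((3 ^ M : ℕ) : ℤ) ↔
              ((3 : ℤ) ^ a) • kolyvaginClass (W.baseChange K) _ hdiv (hA (m / ℓ)) (Pt (m / ℓ))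
                  (hPt (m / ℓ)) ∈
                (W.baseChange K).torsionLocalKer (v.adicCompletion K) ((3 ^ M : ℕ) : ℤ)))))
    (e : geomTorsion (W.baseChange K) ((3 ^ M₀ * 3 ^ M₀ : ℕ) : ℤ) →
      geomTorsion (W.baseChange K) ((3 ^ M₀ * 3 ^ M₀ : ℕ) : ℤ) → AlgebraicClosure K)
    (hμ : ∀ S T, e S T ^ (3 ^ M₀ * 3 ^ M₀) = 1)
    (hadd₁ : ∀ S₁ S₂ T, e (S₁ + S₂) T = e S₁ T * e S₂ T)
    (hadd₂ : ∀ S T₁ T₂, e S (T₁ + T₂) = e S T₁ * e S T₂)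
    (hgal : ∀ (σ : absoluteGaloisGroup K) (S T : geomTorsion (W.baseChange K) ((3 ^ M₀ * 3 ^ M₀ : ℕ) : ℤ)),
      σ • e S T = e (σ • S) (σ • T))
    (halt : ∀ T, e T T = 1) (hnondeg : ∀ T, (∀ S, e S T = 1) → T = 0)
    (inv : LocalInvariants K (3 ^ M₀ * 3 ^ M₀)) (hPT' : inv.SumInvLocalizationEqZero)
    (hinv : ∀ v : HeightOneSpectrum (𝓞 K), Injective (inv (Sum.inr v)))
    (hH3 : ∀ x : galoisCohomology (mu K (3 ^ M₀ * 3 ^ M₀)) 3,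
      (∀ v : Place K, galoisCohomology.localization (mu K (3 ^ M₀ * 3 ^ M₀)) v 3 x = 0) → x = 0)
    (hB : Literature.GroupTheory.FiniteAbelian.IsLevelPairing (3 ^ M₀)
      (ctLevelPairing (W.baseChange K) (3 ^ M₀) e hμ hadd₁ hadd₂ hgal inv halt hPT' hH3
        (localTerm_finite_support (W := W.baseChange K) (m := 3 ^ M₀) (e := e) (hμ := hμ)
          (hadd₁ := hadd₁) (hadd₂ := hadd₂) (hgal := hgal) halt inv)))
    (hPτ : ∀ z ∈ selmerGroup (W.baseChange K) ((3 ^ M₀ * 3 ^ M₀ : ℕ) : ℤ),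
      ∀ t ∈ selmerGroup (W.baseChange K) ((3 ^ M₀ * 3 ^ M₀ : ℕ) : ℤ),
      ctGeneralFun (W.baseChange K) (3 ^ M₀) e hμ hadd₁ hadd₂ hgal inv
          (torsionH1ToH1 (W.baseChange K) _ (conjAct W c _ z))
          (torsionH1ToH1 (W.baseChange K) _ (conjAct W c _ t)) =
        ctGeneralFun (W.baseChange K) (3 ^ M₀) e hμ hadd₁ hadd₂ hgal inv
          (torsionH1ToH1 (W.baseChange K) _ z) (torsionH1ToH1 (W.baseChange K) _ t)) :
    Nat.card (AddCommGroup.primaryComponent (W.baseChange K).sha 3) ≤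
      3 ^ (2 * padicValNat 3 (AddSubgroup.zmultiples P).index) := by
  haveI : (W.baseChange K).IsElliptic := inferInstanceAs (W.map (algebraMap ℚ K)).IsElliptic
  rcases Nat.eq_zero_or_pos M₀ with h0 | hpos
  · subst h0
    exact natCard_primaryComponent_sha_le_of_ringClassRationalPointsM_of_poitouTate_three hPT W hN hρ hK ι hin
      hsp hTam hKod hnt hidx0 hv hpointsR
  -- `E(K)[3] = 0`
  have hbot := torsionBy_eq_bot_of_isImaginaryQuadratic W K hK Nat.prime_three (by decide) hρ
  have hA3 : ∀ a : (W.baseChange K).toAffine.Point, ((3 : ℕ) : ℤ) • a = 0 → a = 0 := fun a ha ↦ by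
    have : a ∈ AddSubgroup.torsionBy (W.baseChange K).toAffine.Point ((3 : ℕ) : ℤ) := by
      rw [mem_torsionBy_iff]; exact ha
    rw [hbot] at this
    exact this
  -- McCallum Lemma 5.1: `ord_3 [E(K) : ℤP] = M₀ ⟺ 3^{M₀} ∥ P`
  obtain ⟨⟨x₀, hx₀⟩, hmax'⟩ :=
    Summit.BirchSwinnertonDyer.Rank1Residual.Additive.zsmul_certificate_of_padicValNat_index Nat.prime_three
      hA3 hnt hidx0.ne' hv
  have hx₀' : 3 ^ M₀ • x₀ = P := by rw [← natCast_zsmul]; exact hx₀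
  have hmax : ∀ Q : (W.baseChange K).toAffine.Point, 3 ^ (M₀ + 1) • Q ≠ P := fun Q hQ ↦
    hmax' ⟨Q, by rw [natCast_zsmul]; exact hQ⟩
  rw [hv]
  exact (card_sha_three_primary_le_of_ringClassRationalPointsM_of_poitouTate_of_localDuality hPT W hN hρ hK ι
    hin hsp hTam hKod hnt hpos hc hcc hx₀' hmax hpointsR e hμ hadd₁ hadd₂ hgal halt hnondeg inv hPT' hinv hH3
    hB hPτ).2.2.1

end Summit.BirchSwinnertonDyer.BirchSwinnertonDyer.Theorems.ShimuraKolyvaginLocalShift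
end
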